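import Literature.IUT.HodgeTheaters.ProfiniteCompletionQuotients
import HarnessLib

/-!
# [IUTchI] §2 plumbing, III: integer powers inside procyclic closures `closure(η⟨u⟩) ⊆ F̂`

Mochizuki, *Inter-universal Teichmüller theory I*, §2, end of the proof of Theorem 2.6 (kurims
May-2020 manuscript p. 57): "we conclude that `γ ∈ G · N_Ĝ(H_x) = G · Ĥ_x`, `γ ∈ G · N_Ĝ(H_y) = G · Ĥ_y`.
Thus, by projecting to `Ĝ^{ab}`, and applying the fact that `M` is of rank two, we conclude that
`γ ∈ G`."  The content of this "projection to `Ĝ^{ab}`" step is the following elementary statement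
about the closure `Ĥ_u = closure(η⟨u⟩)` of a cyclic subgroup in the profinite completion `F̂`
(Mathlib's `ProfiniteGrp.ProfiniteCompletion`, in the owner's vocabulary `profiniteCompletion F`,
`toCompletion F` of `DiscreteProfiniteConjugates.lean`, abc-iut-L5-t1), which we PROVE here by
pushing to the finite cyclic quotients `G₁ → ℤ → ℤ/m` of a finite-index subgroup `G₁ ⊆ F` carrying
the character — no `Ẑ`-module theory is needed [cite: Mochizuki2012, Thm 2.6 p.57] (D-0012 claim
key, status disputed; plain profinite group theory, takes no side):

* `mem_image_zpowers_of_mul_mem_closure_ker` — let `G₁ ⊆ F` have finite index and let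
  `f : G₁ → ℤ` be a character with `f(u) ≠ 0` (`u ∈ G₁`); if `a ∈ Ĥ_u` and `η(c) · a` lies in the
  closure of `η(Ker f)` for some `c ∈ F`, then `a = η(u^k)` is a GENUINE integer power (namely
  `k = −f(c)/f(u)`; one shows `c ∈ G₁` first);
* `mem_range_of_mem_mul_closure_zpowers` — the form used on p. 57: if `γ ∈ η(F) · Ĥ_u` and
  `γ ∈ η(F) · Ĥ_v` where some character `f` of a finite-index `G₁ ∋ u, v` has `f(u) ≠ 0 = f(v)` (the
  "rank two" of `M`), then `γ ∈ η(F)`.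

Theorems only; consumer: the Thm 2.6 (b) assembly of abc-iut-L5-t9.
-/

namespace Literature.IUT.HodgeTheaters.ProfiniteCompletion

open CategoryTheory ProfiniteGrp ProfiniteGrp.ProfiniteCompletion Topology Pointwise

universe u

variable {F : Type u} [Group F]

/-- **Integer powers in a procyclic closure are detected by a character.**  Let `G₁ ⊆ F` be a
subgroup of finite index, `f : G₁ → ℤ` (written multiplicatively) with `f(u) ≠ 0` for some `u ∈ G₁`,
let `a ∈ closure(η⟨u⟩) ⊆ F̂`, and suppose `η(c) · a ∈ closure(η(Ker f))` for some `c ∈ F`.  Then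
`a ∈ η(⟨u⟩)`, i.e. `a = η(u^k)` for an integer `k` (proof: `c ∈ G₁`, and in the finite quotients
`G₁ → ℤ/(|f u|·[F:N])` one reads `f(c) + k_N·f(u) ≡ 0`, whence `f(u) ∣ f(c)` and
`k_N ≡ −f(c)/f(u) (mod [F:N])` at every level `N`). [cite: Mochizuki2012, Thm 2.6 p.57] -/
theorem mem_image_zpowers_of_mul_mem_closure_ker (G₁ : Subgroup F) [G₁.FiniteIndex]
    (f : G₁ →* Multiplicative ℤ) {u : F} (hu₁ : u ∈ G₁) (hu : f ⟨u, hu₁⟩ ≠ 1)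
    {a : profiniteCompletion F}
    (ha : a ∈ closure (toCompletion F '' (Subgroup.zpowers u : Set F))) (c : F)
    (hc : toCompletion F c * a ∈ closure (toCompletion F '' (f.ker.map G₁.subtype : Set F))) :
    a ∈ toCompletion F '' (Subgroup.zpowers u : Set F) := by
  classical
  -- what the two closure hypotheses say at a level `N'`
  have extract : ∀ N' : FiniteIndexNormalSubgroup F, ∃ (k : ℤ) (z₁ : G₁), f z₁ = 1 ∧
      a.val N' = (QuotientGroup.mk (u ^ k) : F ⧸ N'.toSubgroup) ∧
      (z₁ : F)⁻¹ * (c * u ^ k) ∈ N'.toSubgroup := by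
    intro N'
    obtain ⟨x, hx, hxa⟩ := Subgroup.mem_map.mp (val_mem_map_of_mem_closure ha N')
    obtain ⟨k, rfl⟩ := Subgroup.mem_zpowers_iff.mp hx
    obtain ⟨z, hz, hzc⟩ := Subgroup.mem_map.mp (val_mem_map_of_mem_closure hc N')
    obtain ⟨z₁, hz₁, rfl⟩ := Subgroup.mem_map.mp hz
    refine ⟨k, z₁, hz₁, hxa.symm, ?_⟩
    let π : profiniteCompletion F →* F ⧸ N'.toSubgroup :=
      MonoidHom.mk' (fun y => (y.val N' : F ⧸ N'.toSubgroup)) fun _ _ => rfl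
    have hπa : π a = QuotientGroup.mk (u ^ k) := hxa.symm
    have hprod : (QuotientGroup.mk (z₁ : F) : F ⧸ N'.toSubgroup) =
        QuotientGroup.mk (c * u ^ k) := by
      have h1 : (QuotientGroup.mk (z₁ : F) : F ⧸ N'.toSubgroup) = π (toCompletion F c * a) := hzc
      rw [h1, map_mul, hπa, QuotientGroup.mk_mul]
      rfl
    exact QuotientGroup.eq.mp hprod
  -- Step 0: `c ∈ G₁`
  have hcG : c ∈ G₁ := by
    obtain ⟨k, z₁, -, -, hmem⟩ := extract (FiniteIndexNormalSubgroup.ofSubgroup G₁.normalCore)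
    have h1 : (z₁ : F)⁻¹ * (c * u ^ k) ∈ G₁ := G₁.normalCore_le hmem
    have h2 : c = z₁ * ((z₁ : F)⁻¹ * (c * u ^ k)) * (u ^ k)⁻¹ := by group
    rw [h2]
    exact G₁.mul_mem (G₁.mul_mem z₁.2 h1) (G₁.inv_mem (G₁.zpow_mem hu₁ k))
  -- additive notation for the character
  set n : ℤ := Multiplicative.toAdd (f ⟨u, hu₁⟩) with hn_def
  have hn : n ≠ 0 := fun h => hu (by
    have : f ⟨u, hu₁⟩ = Multiplicative.ofAdd (Multiplicative.toAdd (f ⟨u, hu₁⟩)) := rfl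
    rw [this, ← hn_def, h]; rfl)
  set ec : ℤ := Multiplicative.toAdd (f ⟨c, hcG⟩) with hec_def
  -- the candidate exponent
  set k₀ : ℤ := -(ec / n) with hk₀
  -- main claim: at every level `N`, `a.val N = u^{k₀} · N`
  have key : ∀ N : FiniteIndexNormalSubgroup F,
      a.val N = (QuotientGroup.mk (u ^ k₀) : F ⧸ N.toSubgroup) := by
    intro N
    -- the finite cyclic quotient `ψ : G₁ → ℤ/m`, `m = |n| · [F : N]`, and its normal core in `F`
    set m : ℕ := n.natAbs * N.toSubgroup.index with hm_def
    have hm0 : m ≠ 0 :=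
      mul_ne_zero (Int.natAbs_ne_zero.mpr hn) Subgroup.FiniteIndex.index_ne_zero
    haveI : NeZero m := ⟨hm0⟩
    let ψ : G₁ →* Multiplicative (ZMod m) :=
      (AddMonoidHom.toMultiplicative (Int.castAddHom (ZMod m))).comp f
    have hψ : ∀ x : G₁, ψ x = 1 ↔ ((Multiplicative.toAdd (f x) : ℤ) : ZMod m) = 0 := fun x => by
      change Multiplicative.ofAdd (((Multiplicative.toAdd (f x) : ℤ) : ZMod m)) = 1 ↔ _
      exact ofAdd_eq_one
    let KF : Subgroup F := ψ.ker.map G₁.subtype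
    haveI : KF.FiniteIndex := ⟨by
      rw [Subgroup.index_map_subtype]
      exact mul_ne_zero Subgroup.FiniteIndex.index_ne_zero Subgroup.FiniteIndex.index_ne_zero⟩
    let Nm : FiniteIndexNormalSubgroup F := FiniteIndexNormalSubgroup.ofSubgroup KF.normalCore
    let N' : FiniteIndexNormalSubgroup F := N ⊓ Nm
    obtain ⟨k, z₁, hz₁, hval, hmem⟩ := extract N'
    -- `z₁⁻¹ · c · u^k ∈ N' ⊆ core(KF) ⊆ KF = Ker ψ`
    have hmem' : (z₁ : F)⁻¹ * (c * u ^ k) ∈ KF :=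
      KF.normalCore_le ((inf_le_right : N' ≤ Nm) hmem)
    obtain ⟨w₁, hw₁, hw₁eq⟩ := Subgroup.mem_map.mp hmem'
    have hw₁' : w₁ = z₁⁻¹ * (⟨c, hcG⟩ * ⟨u, hu₁⟩ ^ k) := by
      apply Subtype.ext
      rw [Subgroup.coe_mul, Subgroup.coe_inv, Subgroup.coe_mul, SubgroupClass.coe_zpow]
      exact hw₁eq
    have hψ1 : ψ (z₁⁻¹ * (⟨c, hcG⟩ * ⟨u, hu₁⟩ ^ k)) = 1 := by rw [← hw₁']; exact hw₁
    rw [map_mul, map_inv, (hψ z₁).mpr (by rw [hz₁]; simp), inv_one, one_mul,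
      hψ, map_mul, map_zpow, toAdd_mul, toAdd_zpow, smul_eq_mul, Int.cast_add,
      ← hec_def, ← hn_def] at hψ1
    -- `m ∣ ec + k * n` in `ℤ`
    have hdvd : (m : ℤ) ∣ ec + k * n := by
      rw [← ZMod.intCast_zmod_eq_zero_iff_dvd, Int.cast_add]
      exact hψ1
    have hm_int : (m : ℤ) = (n.natAbs : ℤ) * (N.toSubgroup.index : ℤ) := by
      rw [hm_def]; push_cast; ring
    -- `n ∣ ec`
    have hn_dvd : n ∣ ec := by
      have h1 : (n.natAbs : ℤ) ∣ ec + k * n :=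
        dvd_trans (Dvd.intro _ hm_int.symm) hdvd
      rw [Int.natAbs_dvd] at h1
      exact (dvd_add_left (dvd_mul_left n k)).mp h1
    have hec : ec = -k₀ * n := by
      rw [hk₀, neg_neg, Int.ediv_mul_cancel_of_dvd hn_dvd]
    -- `[F : N] ∣ k - k₀`
    have hidx : (N.toSubgroup.index : ℤ) ∣ k - k₀ := by
      have h1 : (m : ℤ) ∣ (k - k₀) * n := by
        have : ec + k * n = (k - k₀) * n := by rw [hec]; ring
        rwa [this] at hdvd
      rw [hm_int] at h1
      have h2 : n.natAbs * N.toSubgroup.index ∣ (k - k₀).natAbs * n.natAbs := by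
        have := Int.natAbs_dvd_natAbs.mpr h1
        simpa [Int.natAbs_mul, Int.natAbs_natCast, Int.natAbs_abs] using this
      rw [mul_comm (k - k₀).natAbs] at h2
      exact Int.ofNat_dvd_left.mpr
        (Nat.dvd_of_mul_dvd_mul_left (Int.natAbs_pos.mpr hn) h2)
    -- hence `u^k` and `u^{k₀}` agree modulo `N`
    have hpow : ((QuotientGroup.mk u : F ⧸ N.toSubgroup)) ^ k = (QuotientGroup.mk u) ^ k₀ := by
      refine zpow_eq_zpow_iff_modEq.mpr (Int.modEq_iff_dvd.mpr ?_)
      have hord : ((orderOf (QuotientGroup.mk u : F ⧸ N.toSubgroup) : ℕ) : ℤ) ∣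
          (N.toSubgroup.index : ℤ) :=
        Int.natCast_dvd_natCast.mpr (orderOf_dvd_natCard _)
      exact (dvd_sub_comm.mp (hord.trans hidx))
    -- and `a.val N` is the image of `a.val N' = u^k · N'`
    have hN : a.val N = (QuotientGroup.mk (u ^ k) : F ⧸ N.toSubgroup) :=
      val_mk_eq_of_le a (inf_le_left : N' ≤ N) (u ^ k) hval
    have hfin : (QuotientGroup.mk (u ^ k) : F ⧸ N.toSubgroup) = QuotientGroup.mk (u ^ k₀) := by
      rw [QuotientGroup.mk_zpow, QuotientGroup.mk_zpow, hpow]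
    exact hN.trans hfin
  refine ⟨u ^ k₀, Subgroup.zpow_mem_zpowers u k₀, ?_⟩
  exact (ProfiniteGrp.limit_ext _ _ _ fun N => (key N).symm)


/-- **Passing to a power of the generator.**  For `N ≥ 1`, `⟨r⟩ = ⋃_{0 ≤ j < N} r^j · ⟨r^N⟩` is a finite
union, so `closure(η⟨r⟩) = ⋃_j η(r^j) · closure(η⟨r^N⟩)`: every point of `closure(η⟨r⟩)` is
`η(r^j) · a'` with `a' ∈ closure(η⟨r^N⟩)`.  (Used to move the generator into a subgroup of finite
index carrying the character, e.g. `N = [G : G₁]`.) [cite: Mochizuki2012, Thm 2.6 p.57] -/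
theorem exists_inv_mul_mem_closure_zpowers_pow (r : F) {N : ℕ} (hN : 0 < N)
    {a : profiniteCompletion F} (ha : a ∈ closure (toCompletion F '' (Subgroup.zpowers r : Set F))) :
    ∃ j : ℤ, (toCompletion F (r ^ j))⁻¹ * a ∈
      closure (toCompletion F '' (Subgroup.zpowers (r ^ N) : Set F)) := by
  classical
  -- the finite decomposition of `⟨r⟩`
  have hdec : (Subgroup.zpowers r : Set F) =
      ⋃ j : Fin N, (r ^ (j : ℕ)) • (Subgroup.zpowers (r ^ N) : Set F) := by
    ext x
    simp only [Set.mem_iUnion, SetLike.mem_coe]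
    constructor
    · intro hx
      obtain ⟨i, rfl⟩ := Subgroup.mem_zpowers_iff.mp hx
      have hN' : (0 : ℤ) < N := by exact_mod_cast hN
      refine ⟨⟨(i % N).toNat, ?_⟩, ?_⟩
      · have h1 := Int.emod_lt_of_pos i hN'
        have h2 := Int.emod_nonneg i hN'.ne'
        omega
      · refine Set.mem_smul_set.mpr ⟨(r ^ N) ^ (i / N), Subgroup.zpow_mem_zpowers _ _, ?_⟩
        have h2 := Int.emod_nonneg i hN'.ne'
        rw [smul_eq_mul, Fin.val_mk, ← zpow_natCast r, Int.toNat_of_nonneg h2, ← zpow_natCast r N,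
          ← zpow_mul, ← zpow_add]
        congr 1
        exact Int.emod_add_mul_ediv i N
    · rintro ⟨j, hx⟩
      obtain ⟨y, hy, rfl⟩ := Set.mem_smul_set.mp hx
      obtain ⟨q, rfl⟩ := Subgroup.mem_zpowers_iff.mp hy
      rw [smul_eq_mul, ← zpow_natCast, ← zpow_natCast, ← zpow_mul, ← zpow_add]
      exact Subgroup.zpow_mem_zpowers _ _
  rw [hdec, Set.image_iUnion, closure_iUnion_of_finite, Set.mem_iUnion] at ha
  obtain ⟨j, hj⟩ := ha
  rw [Set.image_smul_distrib, closure_smul, Set.mem_smul_set_iff_inv_smul_mem, smul_eq_mul] at hj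
  exact ⟨(j : ℕ), by rwa [zpow_natCast]⟩

/-- **"By projecting to `Ĝ^{ab}`, and applying the fact that `M` is of rank two, we conclude that
`γ ∈ G`"** (p. 57), in the elementary form consumed by the Theorem 2.6 (b) assembly: if
`γ = η(p) · a = η(q) · b` with `a ∈ closure(η⟨u⟩)`, `b ∈ closure(η⟨v⟩)`, and some character
`f : G₁ → ℤ` of a finite-index subgroup `G₁ ∋ u, v` has `f(u) ≠ 0`, `f(v) = 0`, then `γ ∈ η(F)`.
[cite: Mochizuki2012, Thm 2.6 p.57] -/
theorem mem_range_of_mem_mul_closure_zpowers (G₁ : Subgroup F) [G₁.FiniteIndex]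
    (f : G₁ →* Multiplicative ℤ) {u v : F} (hu₁ : u ∈ G₁) (hv₁ : v ∈ G₁)
    (hu : f ⟨u, hu₁⟩ ≠ 1) (hv : f ⟨v, hv₁⟩ = 1) {γ a b : profiniteCompletion F} {p q : F}
    (ha : a ∈ closure (toCompletion F '' (Subgroup.zpowers u : Set F)))
    (hb : b ∈ closure (toCompletion F '' (Subgroup.zpowers v : Set F)))
    (hγa : γ = toCompletion F p * a) (hγb : γ = toCompletion F q * b) :
    γ ∈ Set.range (toCompletion F) := by
  -- `η(q⁻¹ p) · a = b ∈ closure(η⟨v⟩) ⊆ closure(η(Ker f))`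
  have hvker : (Subgroup.zpowers v : Set F) ⊆ (f.ker.map G₁.subtype : Set F) := by
    intro x hx
    obtain ⟨i, rfl⟩ := Subgroup.mem_zpowers_iff.mp hx
    refine ⟨⟨v, hv₁⟩ ^ i, ?_, ?_⟩
    · show f (⟨v, hv₁⟩ ^ i) = 1
      rw [map_zpow, hv, one_zpow]
    · simp
  have hb' : toCompletion F (q⁻¹ * p) * a ∈
      closure (toCompletion F '' (f.ker.map G₁.subtype : Set F)) := by
    have heq : toCompletion F (q⁻¹ * p) * a = b := by
      rw [map_mul, map_inv, mul_assoc, ← hγa, hγb, inv_mul_cancel_left]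
    rw [heq]
    exact closure_mono (Set.image_mono hvker) hb
  obtain ⟨x, -, hxa⟩ :=
    mem_image_zpowers_of_mul_mem_closure_ker G₁ f hu₁ hu ha (q⁻¹ * p) hb'
  exact ⟨p * x, by rw [map_mul, hxa, hγa]⟩

end Literature.IUT.HodgeTheaters.ProfiniteCompletion
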